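import Summits.AtomisticToContinuum.BoseEinsteinCondensation.Theorems.BECInsertionCorrectorCorrectorClosureNearMinimiserRigidityJensen
import Summits.AtomisticToContinuum.BoseEinsteinCondensation.Theorems.BECInsertionCorrectorCorrectorClosureFlatDomination
import Summits.AtomisticToContinuum.BoseEinsteinCondensation.Theorems.BECInsertionCorrectorCorrectorClosureFidelityLimit
import HarnessLib

/-!
# The doubling quotient is bounded by the inverse residue (line `residue-area-law`,
# sub-goal `doubling_le_inv_residue`)

Crux `BECInsertionCorrector.CorrectorClosure` (item stmt-AtomisticToContinuum-12058), line
`residue-area-law`, sub-goal `doubling_le_inv_residue` — the converse of the line's heart at fixed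
`N`, `L`.

Fix `N`, a box `L > 0` and a measurable pair potential `v ≥ 0` with bounded periodisation. Let
`Θ₀ : Config N → ℝ` be the `N`-body torus Feynman–Kac ground state (`IsPeriodicGroundStateFK`,
continuous) and `Φ₀ : Config (N + 1) → ℝ` the `(N+1)`-body one (continuous, strictly positive).
Add one particle FLAT, `ψ₀ = Θ₀ ∘ vecTail` on `Config (N + 1)`, and let
`Z t = ∫⁻_{cellN (N+1) L} ψ₀ · e^{-tH_{N+1}} ψ₀` (read through `periodicFKSemigroup v L t`). With
`A = L⁻³ (∫_{cell^N} Θ₀(X) ∫_cell Φ₀(x, X) dx dX)²` (the insertion residue of the true ground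
states) we prove `A · Z(2t) · Z(0) ≤ Z(t)²` for every `t ≥ 0`, i.e. `D(t) = Z(2t)Z(0)/Z(t)² ≤ 1/A`.

This is fixed-`N` spectral theory of the compact positive self-adjoint semigroup
`T_s = pfkL2 v L s` on the real Hilbert space `L²(cellN (N+1) L)`:

* `Z(s) = ⟪T_s[ψ₀], [ψ₀]⟫` for `s > 0` (`inner_pfkL2_toLp`, Bochner = lower integral for the
  nonnegative integrand; the functional of the flat datum is finite by flat domination), and
  `Z(0) = L³ = ‖[ψ₀]‖²` (`stub_flatDomination`);
* `[Φ₀]` is a unit eigenvector of `T_s` with eigenvalue `e^{-sE₀}` (`pfkL2_toLp_groundState`) and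
  pairs positively with the Perron–Frobenius eigenvector, so `‖T_s‖ = e^{-sE₀}`
  (`pfkL2_perronFrobenius`), whence `Z(2t) = ‖T_t ψ‖² = ‖T_{t/2}T_{t/2}ψ‖² ≤ e^{-E₀t}‖T_{t/2}ψ‖² =
  e^{-E₀t} Z(t)`;
* splitting `ψ = ⟪e, ψ⟫e + ψ^⊥` with `e = [Φ₀]`, symmetry and positivity of `T_t` give
  `Z(t) = ⟪T_t ψ, ψ⟫ ≥ e^{-E₀t}⟪e, ψ⟫²`;
* hence `⟪e,ψ⟫² Z(2t) ≤ ⟪e,ψ⟫² e^{-E₀t} Z(t) ≤ Z(t)²`, and `⟪e, ψ⟫ = ∫ Θ₀ ∫_cell Φ₀(x, ·)`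
  (`fid_overlap_eq`), `A · Z(0) = ⟪e, ψ⟫²`; at `t = 0` the claim is Cauchy–Schwarz
  `⟪e, ψ⟫² ≤ ‖ψ‖² = L³`.
-/

noncomputable section

open MeasureTheory Filter Matrix
open scoped ENNReal NNReal BigOperators InnerProductSpace

namespace Summit.AtomisticToContinuum.BoseEinsteinCondensation.Theorems.CorrectorClosure.ResidueAreaLaw

open Literature.MathematicalPhysics.QuantumManyBody.BoseGas
open Summit.AtomisticToContinuum.BoseEinsteinCondensation.Theorems.CorrectorClosure.HealingScaleKacInsertion

variable {N : ℕ}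

/-! ### Two elementary Hilbert-space facts -/

/-- **Two-level lower bound.** If `T` is symmetric with `⟪T x, x⟫ ≥ 0` for all `x`, and
`T e = λ e` for a unit vector `e`, then `λ ⟪e, x⟫² ≤ ⟪T x, x⟫` for every `x` (split
`x = ⟪e, x⟫ e + x^⊥`: the cross terms vanish and `⟪T x^⊥, x^⊥⟫ ≥ 0`). [folklore] -/
theorem dli_mul_inner_sq_le_inner {E : Type*} [NormedAddCommGroup E] [InnerProductSpace ℝ E]
    (T : E →L[ℝ] E) (hsym : ∀ x y, ⟪T x, y⟫_ℝ = ⟪x, T y⟫_ℝ) (hpos : ∀ x, 0 ≤ ⟪T x, x⟫_ℝ)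
    {e : E} (he : ‖e‖ = 1) {lam : ℝ} (hTe : T e = lam • e) (x : E) :
    lam * ⟪e, x⟫_ℝ ^ 2 ≤ ⟪T x, x⟫_ℝ := by
  set a : ℝ := ⟪e, x⟫_ℝ with ha
  set x' : E := x - a • e with hx'
  have hee : ⟪e, e⟫_ℝ = 1 := by rw [real_inner_self_eq_norm_sq, he, one_pow]
  have hperp : ⟪e, x'⟫_ℝ = 0 := by
    rw [hx', inner_sub_right, inner_smul_right, hee, ← ha]; ring
  have hx : x = a • e + x' := by rw [hx']; abel
  have hTx'e : ⟪T x', e⟫_ℝ = 0 := by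
    rw [hsym, hTe, inner_smul_right, real_inner_comm, hperp, mul_zero]
  have hexp : ⟪T x, x⟫_ℝ = lam * a ^ 2 + ⟪T x', x'⟫_ℝ := by
    conv_lhs => rw [hx]
    rw [map_add, map_smul, hTe, smul_smul, inner_add_left, inner_add_right, inner_add_right,
      inner_smul_left, inner_smul_left, inner_smul_right, inner_smul_right, hee, hperp, hTx'e]
    simp only [conj_trivial]; ring
  rw [hexp]
  linarith [hpos x']

/-- **`‖e^{-sH} x‖ ≤ e^{-sE₀} ‖x‖` on `L²(cell)` for every `s > 0`** (`L > 0`, measurable `v` with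
bounded periodisation, `E₀ = periodicGroundStateEnergy v M L`), given a strictly positive
Feynman–Kac ground state `Ψ₀`: the class `[Ψ₀]` is an eigenvector of the symmetric operator
`T_s = pfkL2 v L s` with eigenvalue `e^{-sE₀}` and pairs positively with the a.e. positive
Perron–Frobenius eigenvector of `T_s` (`pfkL2_perronFrobenius`), so `e^{-sE₀} = ‖T_s‖`. [folklore] -/
theorem dli_norm_pfkL2_apply_le {M : ℕ} {L : ℝ} {v : ℝ → ℝ≥0∞} (hv : Measurable v) (hL : 0 < L)
    {C : ℝ≥0} (hC : ∀ x, periodizedPotential v L x ≤ C) {Ψ₀ : Config M → ℝ}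
    (hΨ : IsPeriodicGroundStateFK v L Ψ₀) (hpos : ∀ X, 0 < Ψ₀ X)
    (h0 : MemLp Ψ₀ 2 (volume.restrict (cellN M L))) {s : ℝ} (hs : 0 < s)
    (x : Lp ℝ 2 (volume.restrict (cellN M L))) :
    ‖pfkL2 v L s x‖ ≤ Real.exp (-((periodicGroundStateEnergy v M L).toReal * s)) * ‖x‖ := by
  obtain ⟨-, e, -, -, hTe, hepos, -⟩ := pfkL2_perronFrobenius (N := M) hv hL hC hs
  have hTx₀ := pfkL2_toLp_groundState hv hL hs hΨ h0
  have hx₀pos : ∀ᵐ X ∂(volume.restrict (cellN M L)), 0 < (h0.toLp Ψ₀ : Config M → ℝ) X := by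
    filter_upwards [h0.coeFn_toLp] with X hX
    rw [hX]; exact hpos X
  have hinner : 0 < ⟪h0.toLp Ψ₀, e⟫_ℝ :=
    inner_pos_of_ae_pos (restrict_cellN_ne_zero M hL) hx₀pos hepos
  have hnorm : ‖(pfkL2 v L s : Lp ℝ 2 (volume.restrict (cellN M L)) →L[ℝ] _)‖ =
      Real.exp (-((periodicGroundStateEnergy v M L).toReal * s)) := by
    have h := inner_pfkL2_comm hv hL hs (h0.toLp Ψ₀) e
    rw [hTx₀, hTe, inner_smul_left, inner_smul_right] at h
    simp only [conj_trivial] at h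
    exact (mul_right_cancel₀ hinner.ne' h).symm
  rw [← hnorm]
  exact ContinuousLinearMap.le_opNorm _ x

/-! ### The flat datum `ψ₀ = Θ₀ ∘ vecTail` as an element of `L²(cellN (N+1) L)` -/

/-- The flat datum `Θ₀ ∘ vecTail` is `Lℤ³`-periodic in every particle of `Config (N + 1)` when `Θ₀`
is periodic in every particle of `Config N`. [folklore] -/
theorem dli_tail_periodic {L : ℝ} {Θ₀ : Config N → ℝ}
    (hper : ∀ (X : Config N) (i : Fin N) (k : Fin 3),
      Θ₀ (X + Pi.single i (EuclideanSpace.single k L)) = Θ₀ X)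
    (X : Config (N + 1)) (i : Fin (N + 1)) (k : Fin 3) :
    Θ₀ (vecTail (X + Pi.single i (EuclideanSpace.single k L))) = Θ₀ (vecTail X) := by
  cases i using Fin.cases with
  | zero => rw [fid_vecTail_add_single_zero]
  | succ j => rw [fid_vecTail_add_single_succ, hper]

/-- The flat datum of a continuous periodic `Θ₀` has an `L²(cell)` class (`L > 0`). [folklore] -/
theorem dli_memLp_tail {L : ℝ} (hL : 0 < L) {Θ₀ : Config N → ℝ} (hΘc : Continuous Θ₀)
    (hper : ∀ (X : Config N) (i : Fin N) (k : Fin 3),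
      Θ₀ (X + Pi.single i (EuclideanSpace.single k L)) = Θ₀ X) :
    MemLp (fun X : Config (N + 1) => Θ₀ (vecTail X)) 2 (volume.restrict (cellN (N + 1) L)) :=
  memLp_two_cellN_of_continuous_periodic hL
    (hΘc.comp (continuous_pi fun j => continuous_apply (Fin.succ j)))
    (fun X i k => dli_tail_periodic hper X i k)

/-- The functional of the flat datum is finite everywhere:
`(e^{-sH_{N+1}} ψ₀)(X) ≤ (e^{-sH_N} Θ₀)(tail X) = e^{-sE₀(N)} Θ₀(tail X) < ∞` for `s ≥ 0` (flat
domination and the eigen-relation of `Θ₀`). [folklore] -/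
theorem dli_semigroup_tail_ne_top {v : ℝ → ℝ≥0∞} (hv : Measurable v) {L : ℝ} {Θ₀ : Config N → ℝ}
    (hΘ : IsPeriodicGroundStateFK v L Θ₀) {s : ℝ} (hs : 0 ≤ s) (X : Config (N + 1)) :
    periodicFKSemigroup v L s (fun Y => ENNReal.ofReal (Θ₀ (vecTail Y))) X ≠ ⊤ := by
  have hΘm : Measurable fun Y : Config N => ENNReal.ofReal (Θ₀ Y) :=
    ENNReal.measurable_ofReal.comp hΘ.measurable
  have hle := flatDom_periodicFKSemigroup_tail_le hv L s hΘm X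
  rw [hΘ.eigen s hs (vecTail X)] at hle
  exact ne_top_of_le_ne_top ENNReal.ofReal_ne_top hle

/-- **The flat insertion partition function is a diagonal matrix element of `e^{-sH}` on
`L²(cell)`**: for `s > 0`, `Z(s) = ⟪e^{-sH}[ψ₀], [ψ₀]⟫` read in `ℝ`, `[ψ₀]` the `L²(cell)` class of
the flat datum `ψ₀ = Θ₀ ∘ vecTail` (`inner_pfkL2_toLp`, then Bochner = lower integral for the
nonnegative integrand). [folklore] -/
theorem dli_toReal_Z_eq_inner {v : ℝ → ℝ≥0∞} (hv : Measurable v) {L : ℝ} (hL : 0 < L)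
    {Θ₀ : Config N → ℝ} (hΘ : IsPeriodicGroundStateFK v L Θ₀)
    (h2 : MemLp (fun X : Config (N + 1) => Θ₀ (vecTail X)) 2 (volume.restrict (cellN (N + 1) L)))
    {s : ℝ} (hs : 0 < s) :
    (∫⁻ X in cellN (N + 1) L, ENNReal.ofReal (Θ₀ (vecTail X)) *
        periodicFKSemigroup v L s (fun Y => ENNReal.ofReal (Θ₀ (vecTail Y))) X).toReal =
      ⟪pfkL2 v L s (h2.toLp _), h2.toLp _⟫_ℝ := by
  have hgm : Measurable fun X : Config (N + 1) => Θ₀ (vecTail X) :=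
    hΘ.measurable.comp measurable_vecTail
  have hg0 : ∀ X : Config (N + 1), 0 ≤ Θ₀ (vecTail X) := fun X => hΘ.nonneg _
  have hper : ∀ (X : Config (N + 1)) (i : Fin (N + 1)) (k : Fin 3),
      Θ₀ (vecTail (X + Pi.single i (EuclideanSpace.single k L))) = Θ₀ (vecTail X) :=
    fun X i k => dli_tail_periodic hΘ.periodic X i k
  have hint : ∫ X in cellN (N + 1) L, Θ₀ (vecTail X) * pfkReal v L s (fun Y => Θ₀ (vecTail Y)) X =
      (∫⁻ X in cellN (N + 1) L, ENNReal.ofReal (Θ₀ (vecTail X)) *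
        periodicFKSemigroup v L s (fun Y => ENNReal.ofReal (Θ₀ (vecTail Y))) X).toReal := by
    rw [integral_eq_lintegral_of_nonneg_ae
        (Eventually.of_forall fun X => mul_nonneg (hg0 X) (pfkReal_nonneg v L s hg0 X))
        (hgm.mul (measurable_pfkReal hv L s hgm)).aestronglyMeasurable]
    congr 1
    refine lintegral_congr fun X => ?_
    rw [ENNReal.ofReal_mul (hg0 X), pfkReal_eq_toReal_periodicFKSemigroup hv L s hgm hg0 X,
      ENNReal.ofReal_toReal (dli_semigroup_tail_ne_top hv hΘ hs.le X)]
  rw [inner_pfkL2_toLp hv hL hs h2 h2 hper, hint]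

/-- The class of the flat datum has `‖[ψ₀]‖² = L³`
(`∫_{cell × cell^N} Θ₀(Y)² dx dY = L³ · 1`, `flatDom_setLIntegral_tail_mul`). [folklore] -/
theorem dli_norm_toLp_tail_sq {v : ℝ → ℝ≥0∞} {L : ℝ} (hL : 0 < L) {Θ₀ : Config N → ℝ}
    (hΘ : IsPeriodicGroundStateFK v L Θ₀)
    (h2 : MemLp (fun X : Config (N + 1) => Θ₀ (vecTail X)) 2 (volume.restrict (cellN (N + 1) L))) :
    ‖h2.toLp _‖ ^ 2 = L ^ 3 := by
  have h1 : ENNReal.ofReal (‖h2.toLp _‖ ^ 2) = ENNReal.ofReal (L ^ 3) := by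
    rw [ofReal_norm_toLp_sq h2, ← one_mul (ENNReal.ofReal (L ^ 3)),
      ← flatDom_setLIntegral_tail_mul hL hΘ 1]
    refine lintegral_congr fun X => ?_
    rw [one_mul, sq, ENNReal.ofReal_mul (hΘ.nonneg _)]
  have h := congrArg ENNReal.toReal h1
  rwa [ENNReal.toReal_ofReal (sq_nonneg _), ENNReal.toReal_ofReal (pow_nonneg hL.le 3)] at h

/-- **The overlap of the classes is the residue integral**:
`⟪[Φ₀], [ψ₀]⟫ = ∫_{cell^N} Θ₀(X) ∫_cell Φ₀(x, X) dx dX` for the continuous FK ground states `Θ₀`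
(`N` bodies) and `Φ₀` (`N + 1` bodies) (`inner_toLp_cellN` and `fid_overlap_eq`). [folklore] -/
theorem dli_inner_toLp_eq {v : ℝ → ℝ≥0∞} {L : ℝ} (hL : 0 < L) {Θ₀ : Config N → ℝ}
    (hΘ : IsPeriodicGroundStateFK v L Θ₀) (hΘc : Continuous Θ₀) {Φ₀ : Config (N + 1) → ℝ}
    (hΦ : IsPeriodicGroundStateFK v L Φ₀) (hΦc : Continuous Φ₀)
    (hΦ2 : MemLp Φ₀ 2 (volume.restrict (cellN (N + 1) L)))
    (h2 : MemLp (fun X : Config (N + 1) => Θ₀ (vecTail X)) 2 (volume.restrict (cellN (N + 1) L))) :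
    ⟪hΦ2.toLp Φ₀, h2.toLp _⟫_ℝ = ∫ X in cellN N L, Θ₀ X * ∫ x in cell L, Φ₀ (vecCons x X) := by
  obtain ⟨M, -, hM⟩ := exists_bound_of_continuous_periodic hL hΘc hΘ.periodic
  obtain ⟨M', -, hM'⟩ := exists_bound_of_continuous_periodic hL hΦc hΦ.periodic
  have hI0 : 0 ≤ ∫ X in cellN N L, Θ₀ X * ∫ x in cell L, Φ₀ (vecCons x X) :=
    setIntegral_nonneg (measurableSet_cellN N L) fun X _ =>
      mul_nonneg (hΘ.nonneg X) (setIntegral_nonneg (measurableSet_cell L) fun x _ => hΦ.nonneg _)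
  have ha0 : 0 ≤ ∫ X in cellN (N + 1) L, Φ₀ X * Θ₀ (vecTail X) :=
    setIntegral_nonneg (measurableSet_cellN (N + 1) L) fun X _ =>
      mul_nonneg (hΦ.nonneg X) (hΘ.nonneg _)
  have hprod : Integrable (fun X => Φ₀ X * Θ₀ (vecTail X)) (volume.restrict (cellN (N + 1) L)) :=
    hΦ2.integrable_mul h2
  rw [inner_toLp_cellN hΦ2 h2, ← ENNReal.ofReal_eq_ofReal_iff ha0 hI0,
    ← fid_overlap_eq hΘ.measurable hΘ.nonneg hM hΦc hΦ.nonneg hM',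
    ofReal_integral_eq_lintegral_ofReal hprod
      (Eventually.of_forall fun X => mul_nonneg (hΦ.nonneg X) (hΘ.nonneg _))]
  exact lintegral_congr fun X => ENNReal.ofReal_mul (hΦ.nonneg X)

/-! ### The sub-goal -/

/-- **Sub-goal `doubling_le_inv_residue` of line `residue-area-law` — `D(t) ≤ 1/A` at fixed `N`,
`L > 0` (the converse of the line's heart).** With `Θ₀`, `Φ₀` the continuous torus FK ground states
of `N` and `N + 1` bodies (`Φ₀ > 0`, bounded `v^per`), `ψ₀ = Θ₀ ∘ vecTail`,
`Z t = ∫_{cellN (N+1) L} ψ₀ · e^{-tH_{N+1}}ψ₀` and `A = L⁻³(∫_{cell^N} Θ₀(X) ∫_cell Φ₀(x, X) dx dX)²`: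
`A · Z(2t) · Z(0) ≤ Z(t)²` for every `t ≥ 0`. Proof in `L²(cellN (N+1) L)` with `T_s = pfkL2 v L s`,
`ψ = [ψ₀]`, `e = [Φ₀]` (unit eigenvector of `T_s`, eigenvalue `e^{-sE₀}`, `E₀ = E₀(N+1)`):
`Z(s) = ⟪T_s ψ, ψ⟫` (`s > 0`), `Z(0) = L³` (`stub_flatDomination`), `⟪e, ψ⟫ = ∫ Θ₀ ∫_cell Φ₀`, so the
claim reads `⟪e,ψ⟫² Z(2t) ≤ Z(t)²`; `‖T_s‖ = e^{-sE₀}` (Perron–Frobenius) gives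
`Z(2t) = ‖T_{t/2}T_{t/2}ψ‖² ≤ e^{-E₀t} Z(t)`, and the two-level splitting `ψ = ⟪e,ψ⟩e + ψ^⊥` with
`⟪T_t ψ^⊥, ψ^⊥⟫ ≥ 0` gives `Z(t) ≥ e^{-E₀t}⟪e,ψ⟫²`; multiply. At `t = 0` it is Cauchy–Schwarz
`⟪e,ψ⟫² ≤ ‖ψ‖² = L³`. [folklore] -/
theorem doubling_le_inv_residue (v : ℝ → ℝ≥0∞) (hv : Measurable v) (N : ℕ) (L : ℝ) (hL : 0 < L)
    (hb : ∃ C : ℝ≥0, ∀ x, periodizedPotential v L x ≤ C)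
    (Θ₀ : Config N → ℝ) (hΘ : IsPeriodicGroundStateFK v L Θ₀) (hΘc : Continuous Θ₀)
    (Φ₀ : Config (N + 1) → ℝ) (hΦ : IsPeriodicGroundStateFK v L Φ₀) (hΦc : Continuous Φ₀)
    (hΦp : ∀ X, 0 < Φ₀ X) (Z : ℝ → ℝ≥0∞)
    (hZ : Z = fun t => ∫⁻ X in cellN (N + 1) L, ENNReal.ofReal (Θ₀ (vecTail X)) *
      periodicFKSemigroup v L t (fun Y => ENNReal.ofReal (Θ₀ (vecTail Y))) X) (t : ℝ) (ht : 0 ≤ t) :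
    ENNReal.ofReal ((L ^ 3)⁻¹ * (∫ X in cellN N L, Θ₀ X * ∫ x in cell L, Φ₀ (vecCons x X)) ^ 2) *
        (Z (2 * t) * Z 0) ≤ Z t ^ 2 := by
  obtain ⟨C, hC⟩ := hb
  -- `Z 0 = L³` and `Z < ∞`
  have hZ0 : Z 0 = ENNReal.ofReal (L ^ 3) := (stub_flatDomination v hv N L hL Θ₀ hΘ Z hZ).1
  have hZtop : ∀ s : ℝ, 0 ≤ s → Z s ≠ ⊤ := fun s hs =>
    ne_top_of_le_ne_top ENNReal.ofReal_ne_top ((stub_flatDomination v hv N L hL Θ₀ hΘ Z hZ).2 s hs)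
  -- the Hilbert-space objects: `ψ = [Θ₀ ∘ vecTail]`, `e = [Φ₀]`, the residue integral `I`
  have h2 : MemLp (fun X : Config (N + 1) => Θ₀ (vecTail X)) 2
      (volume.restrict (cellN (N + 1) L)) := dli_memLp_tail hL hΘc hΘ.periodic
  have hΦ2 : MemLp Φ₀ 2 (volume.restrict (cellN (N + 1) L)) :=
    memLp_two_cellN_of_continuous_periodic hL hΦc hΦ.periodic
  set ψ : Lp ℝ 2 (volume.restrict (cellN (N + 1) L)) := h2.toLp fun X => Θ₀ (vecTail X)
  set e : Lp ℝ 2 (volume.restrict (cellN (N + 1) L)) := hΦ2.toLp Φ₀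
  set I : ℝ := ∫ X in cellN N L, Θ₀ X * ∫ x in cell L, Φ₀ (vecCons x X)
  have he1 : ‖e‖ = 1 := norm_toLp_groundState hΦ hΦ2
  have hψsq : ‖ψ‖ ^ 2 = L ^ 3 := dli_norm_toLp_tail_sq hL hΘ h2
  have heψ : ⟪e, ψ⟫_ℝ = I := dli_inner_toLp_eq hL hΘ hΘc hΦ hΦc hΦ2 h2
  have hZs : ∀ s : ℝ, 0 < s → (Z s).toReal = ⟪pfkL2 v L s ψ, ψ⟫_ℝ := fun s hs => by
    rw [hZ]; exact dli_toReal_Z_eq_inner hv hL hΘ h2 hs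
  -- the key real inequality `I² · Z(2t) ≤ Z(t)²`
  have hkey : I ^ 2 * (Z (2 * t)).toReal ≤ (Z t).toReal ^ 2 := by
    rcases ht.eq_or_lt with rfl | ht'
    · -- `t = 0`: Cauchy–Schwarz `⟪e, ψ⟫² ≤ ‖ψ‖² = L³ = Z 0`
      rw [mul_zero, hZ0, ENNReal.toReal_ofReal (pow_nonneg hL.le 3), ← hψsq, ← heψ, sq (‖ψ‖ ^ 2)]
      refine mul_le_mul_of_nonneg_right ?_ (sq_nonneg _)
      have h := abs_real_inner_le_norm e ψ
      rw [he1, one_mul] at h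
      have h' := pow_le_pow_left₀ (abs_nonneg _) h 2
      rwa [sq_abs] at h'
    · -- `t > 0`: spectral theory of `T_t`
      set Eₑ : ℝ := (periodicGroundStateEnergy v (N + 1) L).toReal
      have h2t : 0 < 2 * t := by positivity
      have hsym : ∀ x y : Lp ℝ 2 (volume.restrict (cellN (N + 1) L)),
          ⟪pfkL2 v L t x, y⟫_ℝ = ⟪x, pfkL2 v L t y⟫_ℝ := fun x y => inner_pfkL2_comm hv hL ht' x y
      have hpos : ∀ x : Lp ℝ 2 (volume.restrict (cellN (N + 1) L)), 0 ≤ ⟪pfkL2 v L t x, x⟫_ℝ :=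
        fun x => inner_pfkL2_self_nonneg hv hL ht' x
      have hTe : pfkL2 v L t e = Real.exp (-(Eₑ * t)) • e := pfkL2_toLp_groundState hv hL ht' hΦ hΦ2
      -- lower bound `e^{-E₀t} ⟪e, ψ⟫² ≤ Z(t)`
      have hlow : Real.exp (-(Eₑ * t)) * I ^ 2 ≤ (Z t).toReal := by
        rw [hZs t ht', ← heψ]
        exact dli_mul_inner_sq_le_inner _ hsym hpos he1 hTe ψ
      -- upper bound `Z(2t) = ‖T_{t/2} T_{t/2} ψ‖² ≤ e^{-E₀t} ‖T_{t/2} ψ‖² = e^{-E₀t} Z(t)`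
      have hhalf : pfkL2 v L t ψ = pfkL2 v L (t / 2) (pfkL2 v L (t / 2) ψ) := by
        rw [pfkL2_eq_comp_half hv hL ht']; rfl
      have hn : ‖pfkL2 v L t ψ‖ ≤ Real.exp (-(Eₑ * (t / 2))) * ‖pfkL2 v L (t / 2) ψ‖ := by
        rw [hhalf]
        exact dli_norm_pfkL2_apply_le hv hL hC hΦ hΦp hΦ2 (half_pos ht') _
      have hexp : Real.exp (-(Eₑ * (t / 2))) ^ 2 = Real.exp (-(Eₑ * t)) := by
        rw [sq, ← Real.exp_add]; congr 1; ring
      have hup : (Z (2 * t)).toReal ≤ Real.exp (-(Eₑ * t)) * (Z t).toReal := by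
        have h22 : (2 : ℝ) * t / 2 = t := by ring
        rw [hZs (2 * t) h2t, hZs t ht', inner_pfkL2_self_eq_norm_sq hv hL h2t,
          inner_pfkL2_self_eq_norm_sq hv hL ht', h22]
        calc ‖pfkL2 v L t ψ‖ ^ 2 ≤ (Real.exp (-(Eₑ * (t / 2))) * ‖pfkL2 v L (t / 2) ψ‖) ^ 2 :=
              pow_le_pow_left₀ (norm_nonneg _) hn 2
          _ = Real.exp (-(Eₑ * t)) * ‖pfkL2 v L (t / 2) ψ‖ ^ 2 := by rw [mul_pow, hexp]
      calc I ^ 2 * (Z (2 * t)).toReal ≤ I ^ 2 * (Real.exp (-(Eₑ * t)) * (Z t).toReal) :=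
            mul_le_mul_of_nonneg_left hup (sq_nonneg _)
        _ = Real.exp (-(Eₑ * t)) * I ^ 2 * (Z t).toReal := by ring
        _ ≤ (Z t).toReal * (Z t).toReal := mul_le_mul_of_nonneg_right hlow ENNReal.toReal_nonneg
        _ = (Z t).toReal ^ 2 := (sq _).symm
  -- back to `[0, ∞]`: all quantities are finite
  obtain ⟨z₂, hz₂, hz₂'⟩ : ∃ z : ℝ≥0∞, z ≠ ⊤ ∧ Z (2 * t) = z := ⟨_, hZtop _ (by positivity), rfl⟩
  obtain ⟨z₁, hz₁, hz₁'⟩ : ∃ z : ℝ≥0∞, z ≠ ⊤ ∧ Z t = z := ⟨_, hZtop _ ht, rfl⟩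
  rw [hz₂', hz₁'] at hkey ⊢
  rw [hZ0, ← ENNReal.ofReal_toReal hz₂, ← ENNReal.ofReal_toReal hz₁,
    ← ENNReal.ofReal_pow ENNReal.toReal_nonneg, ← ENNReal.ofReal_mul ENNReal.toReal_nonneg,
    ← ENNReal.ofReal_mul (by positivity : 0 ≤ (L ^ 3)⁻¹ * I ^ 2)]
  refine ENNReal.ofReal_le_ofReal ?_
  have hL3 : L ^ 3 ≠ 0 := by positivity
  calc (L ^ 3)⁻¹ * I ^ 2 * (z₂.toReal * L ^ 3) = I ^ 2 * z₂.toReal := by field_simp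
    _ ≤ z₁.toReal ^ 2 := hkey

end Summit.AtomisticToContinuum.BoseEinsteinCondensation.Theorems.CorrectorClosure.ResidueAreaLaw

end
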